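import Summits.Ventures.Crystal3D.Theorems.StickyWulffConstantGenericWallFloorSteeringTwin
import Summits.Ventures.Crystal3D.Theorems.StickyWulffConstantGenericWallFloorTopTerminal
import HarnessLib

/-!
# The tube walk pays: a steered coherent walk finds an unsaturated ball inside its tube

HONEST FRAMING. Venture `Summits/Ventures/Crystal3D` (cell `crystal3d-full`), helper for the crux
`GenericWallFloor` (stmt-Ventures-19480) of `route-Ventures-StickyWulffConstant`, REGISTERED line `WallLedgerG`,
open stub `stub_twoSlabAdhesion` (general fillings; ARCH v4 «coherent walks in tubes», first half of the
assembly (A)).  Rung credit only; F-C1 not moved.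

`tube_walk_pays`: fix the top clamped window of the cell (`P₂` on `Λ₂ = A₂·Λ₀ + t₂`, heights
`[h + R₀, h + 2R₀]`, clean top sliver) and a set `𝓕` of frames closed under `{111}` mirrors and avoiding
`A₂(Λ₀)` (the non-chain hypothesis).  If a STATE (ball `y ∈ X`, frame `F ∈ 𝓕`, three independent exact slot
neighbours) sits in the vertical tube of radius `17` around an axis `(p₀, p₁)` with `p₀² + p₁² ≤ (ρ − 20)²`, then
some ball `z ∈ X` with at most eleven contacts lies within horizontal distance `18` of the axis.  Proof:
induction on the height budget `32·(h + 2R₀ + 2 − y₂)`; at each state `walk_moves` pays or offers the twelve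
moves, `exists_steering_slot` / `exists_steering_twinDozen` (with `z = e₃`, `q` = unit horizontal vector towards
the axis) picks one rising by `≥ 1/32` and keeping the walker in the tube (`horiz_step_le`), frames stay in `𝓕`,
and the deep top window is excluded by `not_deep_top_of_frame_mem`.
WHAT THIS IS NOT: not the stub; the grid count and the ledger bookkeeping remain; F-C1 not moved.
-/

noncomputable section

namespace Summit.Ventures.Crystal3D.Theorems

open Summit.Ventures.Crystal3D Finset
open Literature.MathematicalPhysics.StatisticalMechanics (fccStacking)
open scoped InnerProductSpace

/-- Planar Minkowski, squared: `|u + w| ≤ |u| + |w|` in `ℝ²`. -/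
theorem sq2_add_le {u0 u1 w0 w1 R S : ℝ} (hR : 0 ≤ R) (hS : 0 ≤ S) (hu : u0 ^ 2 + u1 ^ 2 ≤ R ^ 2)
    (hw : w0 ^ 2 + w1 ^ 2 ≤ S ^ 2) : (u0 + w0) ^ 2 + (u1 + w1) ^ 2 ≤ (R + S) ^ 2 := by
  have lag : (u0 * w0 + u1 * w1) ^ 2 ≤ (u0 ^ 2 + u1 ^ 2) * (w0 ^ 2 + w1 ^ 2) := by
    nlinarith [sq_nonneg (u0 * w1 - u1 * w0)]
  have prod : (u0 ^ 2 + u1 ^ 2) * (w0 ^ 2 + w1 ^ 2) ≤ R ^ 2 * S ^ 2 :=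
    mul_le_mul hu hw (by positivity) (by positivity)
  have key : u0 * w0 + u1 * w1 ≤ R * S := by
    by_contra hlt
    push Not at hlt
    have hRS : 0 ≤ R * S := mul_nonneg hR hS
    have : (R * S) ^ 2 < (u0 * w0 + u1 * w1) ^ 2 := by nlinarith
    nlinarith
  nlinarith

/-- The steering step keeps the walker in the tube of radius `17`: a unit move `d` with horizontal part of
length `≤ 1`, and with `⟪d, q⟫ ≥ 1/32` towards the axis whenever the walker is at horizontal distance `≥ 16`. -/
theorem horiz_step_le {y0 y1 p0 p1 d0 d1 : ℝ} (hy : (y0 - p0) ^ 2 + (y1 - p1) ^ 2 ≤ 17 ^ 2)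
    (hd : d0 ^ 2 + d1 ^ 2 ≤ 1)
    (hsteer : (16 : ℝ) ^ 2 ≤ (y0 - p0) ^ 2 + (y1 - p1) ^ 2 → 1 / 2 ≤ (p0 - y0) * d0 + (p1 - y1) * d1) :
    (y0 + d0 - p0) ^ 2 + (y1 + d1 - p1) ^ 2 ≤ 17 ^ 2 := by
  have e : (y0 + d0 - p0) ^ 2 + (y1 + d1 - p1) ^ 2 =
      ((y0 - p0) ^ 2 + (y1 - p1) ^ 2) + (d0 ^ 2 + d1 ^ 2) - 2 * ((p0 - y0) * d0 + (p1 - y1) * d1) := by ring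
  by_cases hs : (16 : ℝ) ^ 2 ≤ (y0 - p0) ^ 2 + (y1 - p1) ^ 2
  · have := hsteer hs
    rw [e]; nlinarith
  · push Not at hs
    have lag : ((p0 - y0) * d0 + (p1 - y1) * d1) ^ 2 ≤ ((y0 - p0) ^ 2 + (y1 - p1) ^ 2) * (d0 ^ 2 + d1 ^ 2) := by
      nlinarith [sq_nonneg ((p0 - y0) * d1 - (p1 - y1) * d0)]
    have hb : -16 ≤ (p0 - y0) * d0 + (p1 - y1) * d1 := by
      by_contra hlt
      push Not at hlt
      have : (16 : ℝ) ^ 2 < ((p0 - y0) * d0 + (p1 - y1) * d1) ^ 2 := by nlinarith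
      nlinarith
    rw [e]; nlinarith

/-- **The tube walk pays.**  See the module docstring. -/
theorem tube_walk_pays {δ : ℝ} (hg : KissingGap δ) (hc : KissingClassification δ)
    (X : Finset (EuclideanSpace ℝ (Fin 3))) (hX : ∀ p ∈ X, ∀ q ∈ X, p ≠ q → 1 ≤ dist p q)
    (A₂ : EuclideanSpace ℝ (Fin 3) ≃ₗᵢ[ℝ] EuclideanSpace ℝ (Fin 3)) (t₂ : EuclideanSpace ℝ (Fin 3))
    (P₂ : Finset (EuclideanSpace ℝ (Fin 3))) (R₀ h ρ : ℝ) (hR₀ : 3 ≤ R₀) (hρ : R₀ ≤ ρ) (hρ20 : 20 ≤ ρ)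
    (hP₂X : P₂ ⊆ X) (hcell : ∀ p ∈ X, p 2 ≤ h + 2 * R₀)
    (hP₂ : ∀ p, p ∈ P₂ ↔ (p ∈ (fun q => A₂ q + t₂) '' fccStacking 1 (Real.sqrt (2 / 3)) ∧
      h + R₀ ≤ p 2 ∧ p 2 ≤ h + 2 * R₀ ∧ p 0 ^ 2 + p 1 ^ 2 ≤ ρ ^ 2))
    (hclean₂ : ∀ p ∈ X, h + 2 * R₀ - 1 < p 2 → p ∈ (fun q => A₂ q + t₂) '' fccStacking 1 (Real.sqrt (2 / 3)))
    (𝓕 : Set (EuclideanSpace ℝ (Fin 3) ≃ₗᵢ[ℝ] EuclideanSpace ℝ (Fin 3)))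
    (havoid : ∀ G ∈ 𝓕, G '' fccStacking 1 (Real.sqrt (2 / 3)) ≠ A₂ '' fccStacking 1 (Real.sqrt (2 / 3)))
    (hclosed : ∀ G ∈ 𝓕, ∀ m : EuclideanSpace ℝ (Fin 3), ‖m‖ = 1 →
      (∀ w ∈ fccSlots, ⟪G w, m⟫_ℝ = 0 ∨ ⟪G w, m⟫_ℝ = Real.sqrt (2 / 3) ∨ ⟪G w, m⟫_ℝ = -Real.sqrt (2 / 3)) →
      ∀ G' : EuclideanSpace ℝ (Fin 3) ≃ₗᵢ[ℝ] EuclideanSpace ℝ (Fin 3),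
        (∀ x, G' x = G x - (2 * ⟪G x, m⟫_ℝ) • m) → G' ∈ 𝓕)
    (p0 p1 : ℝ) (hp : p0 ^ 2 + p1 ^ 2 ≤ (ρ - 20) ^ 2) :
    ∀ (k : ℕ) (y : EuclideanSpace ℝ (Fin 3)) (F : EuclideanSpace ℝ (Fin 3) ≃ₗᵢ[ℝ] EuclideanSpace ℝ (Fin 3))
      (a b c : EuclideanSpace ℝ (Fin 3)), y ∈ X → F ∈ 𝓕 → a ∈ fccSlots → b ∈ fccSlots → c ∈ fccSlots →
      LinearIndependent ℝ ![a, b, c] → y + F a ∈ X → y + F b ∈ X → y + F c ∈ X →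
      (y 0 - p0) ^ 2 + (y 1 - p1) ^ 2 ≤ 17 ^ 2 → (h + 2 * R₀ + 2 - y 2) * 32 ≤ k →
      ∃ z ∈ X, (X.filter fun q => dist z q = 1).card ≤ 11 ∧ (z 0 - p0) ^ 2 + (z 1 - p1) ^ 2 ≤ 18 ^ 2 := by
  set e₃ : EuclideanSpace ℝ (Fin 3) := EuclideanSpace.single (2 : Fin 3) (1 : ℝ) with he₃
  have he₃n : ‖e₃‖ = 1 := by rw [he₃, PiLp.norm_single, norm_one]
  have he₃i : ∀ d : EuclideanSpace ℝ (Fin 3), ⟪d, e₃⟫_ℝ = d 2 := fun d => by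
    rw [he₃, EuclideanSpace.inner_single_right]; simp
  -- the paying conclusion from a payer near the walker
  have conclude : ∀ y z : EuclideanSpace ℝ (Fin 3), (y 0 - p0) ^ 2 + (y 1 - p1) ^ 2 ≤ 17 ^ 2 → dist y z ≤ 1 →
      (z 0 - p0) ^ 2 + (z 1 - p1) ^ 2 ≤ 18 ^ 2 := by
    intro y z hy hd
    have hn := norm_sq_eq_fin3 (z - y)
    have hd' : ‖z - y‖ ^ 2 ≤ 1 := by
      rw [← dist_eq_norm, dist_comm]; nlinarith [dist_nonneg (x := y) (y := z)]
    have hw : (z - y) 0 ^ 2 + (z - y) 1 ^ 2 ≤ 1 ^ 2 := by nlinarith [sq_nonneg ((z - y) 2)]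
    have := sq2_add_le (by norm_num : (0 : ℝ) ≤ 17) (by norm_num : (0 : ℝ) ≤ 1) hy hw
    simp only [PiLp.sub_apply] at this
    have e0 : z 0 - p0 = (y 0 - p0) + (z 0 - y 0) := by ring
    have e1 : z 1 - p1 = (y 1 - p1) + (z 1 - y 1) := by ring
    rw [e0, e1]; linarith
  intro k
  induction k with
  | zero =>
    intro y F a b c hy _ _ _ _ _ _ _ _ _ hbud
    have := hcell y hy
    simp only [Nat.cast_zero] at hbud
    linarith
  | succ k ih =>
    intro y F a b c hy hF ha hb hc' hind haX hbX hcX htube hbud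
    rcases walk_moves hg hc hX hy F ha hb hc' hind haX hbX hcX with ⟨z, hz, hdist, hdeg⟩ | hfcc | htwin
    · exact ⟨z, hz, hdeg, conclude y z htube hdist⟩
    · -- the inward horizontal unit vector `q` (or any horizontal unit vector when close to the axis)
      -- common continuation: a move `d` with `y + d ∈ X`, a state there with frame `G ∈ 𝓕`, rise and steering
      have cont : ∀ (d : EuclideanSpace ℝ (Fin 3)) (G : EuclideanSpace ℝ (Fin 3) ≃ₗᵢ[ℝ] EuclideanSpace ℝ (Fin 3)),
          ‖d‖ = 1 → y + d ∈ X → G ∈ 𝓕 →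
          (∃ a' ∈ fccSlots, ∃ b' ∈ fccSlots, ∃ c' ∈ fccSlots, LinearIndependent ℝ ![a', b', c'] ∧
            y + d + G a' ∈ X ∧ y + d + G b' ∈ X ∧ y + d + G c' ∈ X) →
          (1 / 32 : ℝ) ≤ ⟪d, e₃⟫_ℝ →
          ((16 : ℝ) ^ 2 ≤ (y 0 - p0) ^ 2 + (y 1 - p1) ^ 2 → 1 / 2 ≤ (p0 - y 0) * d 0 + (p1 - y 1) * d 1) →
          ∃ z ∈ X, (X.filter fun q => dist z q = 1).card ≤ 11 ∧ (z 0 - p0) ^ 2 + (z 1 - p1) ^ 2 ≤ 18 ^ 2 := by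
        intro d G hd1 hyd hG hst hrise hsteer
        obtain ⟨a', ha', b', hb', c', hc'', hind', h1, h2, h3⟩ := hst
        rw [he₃i] at hrise
        have hdn := norm_sq_eq_fin3 d
        rw [hd1, one_pow] at hdn
        have hdh : d 0 ^ 2 + d 1 ^ 2 ≤ 1 := by nlinarith [sq_nonneg (d 2)]
        have htube' : ((y + d) 0 - p0) ^ 2 + ((y + d) 1 - p1) ^ 2 ≤ 17 ^ 2 := by
          simp only [PiLp.add_apply]
          exact horiz_step_le htube hdh hsteer
        -- the new ball is not deep in the top window
        have hy'2 : (y + d) 2 < h + R₀ + 2 := by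
          by_contra hge
          push Not at hge
          have hlat : (y + d) 0 ^ 2 + (y + d) 1 ^ 2 ≤ (ρ - 2) ^ 2 := by
            have := sq2_add_le (by linarith : (0 : ℝ) ≤ ρ - 20) (by norm_num : (0 : ℝ) ≤ 17) hp
              (show ((y + d) 0 - p0) ^ 2 + ((y + d) 1 - p1) ^ 2 ≤ 17 ^ 2 from htube')
            have e0 : (y + d) 0 = p0 + ((y + d) 0 - p0) := by ring
            have e1 : (y + d) 1 = p1 + ((y + d) 1 - p1) := by ring
            rw [e0, e1]; nlinarith
          exact not_deep_top_of_frame_mem A₂ t₂ X P₂ R₀ h ρ hR₀ hρ hX hP₂X hcell hP₂ hclean₂ 𝓕 havoid hG hyd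
            hge hlat ha' hb' hc'' hind' h1 h2 h3
        apply ih (y + d) G a' b' c' hyd hG ha' hb' hc'' hind' h1 h2 h3 htube'
        have : (y + d) 2 = y 2 + d 2 := by simp only [PiLp.add_apply]
        rw [this]
        push_cast at hbud ⊢
        linarith
      -- choose `q`
      have hq : ∃ q : EuclideanSpace ℝ (Fin 3), ‖q‖ = 1 ∧ ⟪e₃, q⟫_ℝ = 0 ∧
          ∀ d : EuclideanSpace ℝ (Fin 3), (1 / 32 : ℝ) ≤ ⟪d, q⟫_ℝ →
            ((16 : ℝ) ^ 2 ≤ (y 0 - p0) ^ 2 + (y 1 - p1) ^ 2 → 1 / 2 ≤ (p0 - y 0) * d 0 + (p1 - y 1) * d 1) := by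
        by_cases hs : (16 : ℝ) ^ 2 ≤ (y 0 - p0) ^ 2 + (y 1 - p1) ^ 2
        · set V : EuclideanSpace ℝ (Fin 3) := EuclideanSpace.single (0 : Fin 3) (p0 - y 0) +
            EuclideanSpace.single (1 : Fin 3) (p1 - y 1) with hV
          have hVi : ∀ d : EuclideanSpace ℝ (Fin 3), ⟪d, V⟫_ℝ = (p0 - y 0) * d 0 + (p1 - y 1) * d 1 := by
            intro d; rw [hV, inner_add_right, EuclideanSpace.inner_single_right, EuclideanSpace.inner_single_right]
            simp
          have hV0 : V 0 = p0 - y 0 := by simp [hV]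
          have hV1 : V 1 = p1 - y 1 := by simp [hV]
          have hVn2 : ‖V‖ ^ 2 = (y 0 - p0) ^ 2 + (y 1 - p1) ^ 2 := by
            rw [← real_inner_self_eq_norm_sq, hVi, hV0, hV1]; ring
          have hVn : 16 ≤ ‖V‖ := by nlinarith [norm_nonneg V]
          have hVpos : 0 < ‖V‖ := by linarith
          refine ⟨(1 / ‖V‖) • V, ?_, ?_, ?_⟩
          · rw [norm_smul, norm_div, norm_one, Real.norm_eq_abs, abs_of_pos hVpos]
            exact one_div_mul_cancel hVpos.ne'
          · rw [inner_smul_right, hVi]; simp [he₃]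
          · intro d hdq _
            rw [inner_smul_right, hVi] at hdq
            have : ‖V‖ / 32 ≤ (p0 - y 0) * d 0 + (p1 - y 1) * d 1 := by
              have h' := mul_le_mul_of_nonneg_left hdq hVpos.le
              rw [← mul_assoc, mul_one_div_cancel hVpos.ne', one_mul] at h'
              linarith
            linarith
        · refine ⟨EuclideanSpace.single (0 : Fin 3) (1 : ℝ), by rw [PiLp.norm_single, norm_one], ?_,
            fun d _ hs' => absurd hs' hs⟩
          simp [he₃, EuclideanSpace.inner_single_left]
      obtain ⟨q, hq1, hq0, hqst⟩ := hq
      obtain ⟨w, hw, hwz, hwq⟩ := exists_steering_slot F he₃n hq1 hq0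
      obtain ⟨hyw, hst⟩ := hfcc w hw
      have hw1 : ‖F w‖ = 1 := by rw [LinearIsometryEquiv.norm_map, norm_eq_one_of_mem_fccSlots hw]
      exact cont (F w) F hw1 hyw hF hst hwz (hqst _ hwq)
    · obtain ⟨nn, hn, hmenu, F', hF', hown, hmir, -⟩ := htwin
      have cont : ∀ (d : EuclideanSpace ℝ (Fin 3)) (G : EuclideanSpace ℝ (Fin 3) ≃ₗᵢ[ℝ] EuclideanSpace ℝ (Fin 3)),
          ‖d‖ = 1 → y + d ∈ X → G ∈ 𝓕 →
          (∃ a' ∈ fccSlots, ∃ b' ∈ fccSlots, ∃ c' ∈ fccSlots, LinearIndependent ℝ ![a', b', c'] ∧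
            y + d + G a' ∈ X ∧ y + d + G b' ∈ X ∧ y + d + G c' ∈ X) →
          (1 / 32 : ℝ) ≤ ⟪d, e₃⟫_ℝ →
          ((16 : ℝ) ^ 2 ≤ (y 0 - p0) ^ 2 + (y 1 - p1) ^ 2 → 1 / 2 ≤ (p0 - y 0) * d 0 + (p1 - y 1) * d 1) →
          ∃ z ∈ X, (X.filter fun q => dist z q = 1).card ≤ 11 ∧ (z 0 - p0) ^ 2 + (z 1 - p1) ^ 2 ≤ 18 ^ 2 := by
        intro d G hd1 hyd hG hst hrise hsteer
        obtain ⟨a', ha', b', hb', c', hc'', hind', h1, h2, h3⟩ := hst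
        rw [he₃i] at hrise
        have hdn := norm_sq_eq_fin3 d
        rw [hd1, one_pow] at hdn
        have hdh : d 0 ^ 2 + d 1 ^ 2 ≤ 1 := by nlinarith [sq_nonneg (d 2)]
        have htube' : ((y + d) 0 - p0) ^ 2 + ((y + d) 1 - p1) ^ 2 ≤ 17 ^ 2 := by
          simp only [PiLp.add_apply]
          exact horiz_step_le htube hdh hsteer
        have hy'2 : (y + d) 2 < h + R₀ + 2 := by
          by_contra hge
          push Not at hge
          have hlat : (y + d) 0 ^ 2 + (y + d) 1 ^ 2 ≤ (ρ - 2) ^ 2 := by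
            have := sq2_add_le (by linarith : (0 : ℝ) ≤ ρ - 20) (by norm_num : (0 : ℝ) ≤ 17) hp
              (show ((y + d) 0 - p0) ^ 2 + ((y + d) 1 - p1) ^ 2 ≤ 17 ^ 2 from htube')
            have e0 : (y + d) 0 = p0 + ((y + d) 0 - p0) := by ring
            have e1 : (y + d) 1 = p1 + ((y + d) 1 - p1) := by ring
            rw [e0, e1]; nlinarith
          exact not_deep_top_of_frame_mem A₂ t₂ X P₂ R₀ h ρ hR₀ hρ hX hP₂X hcell hP₂ hclean₂ 𝓕 havoid hG hyd
            hge hlat ha' hb' hc'' hind' h1 h2 h3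
        apply ih (y + d) G a' b' c' hyd hG ha' hb' hc'' hind' h1 h2 h3 htube'
        have : (y + d) 2 = y 2 + d 2 := by simp only [PiLp.add_apply]
        rw [this]
        push_cast at hbud ⊢
        linarith
      have hq : ∃ q : EuclideanSpace ℝ (Fin 3), ‖q‖ = 1 ∧ ⟪e₃, q⟫_ℝ = 0 ∧
          ∀ d : EuclideanSpace ℝ (Fin 3), (1 / 32 : ℝ) ≤ ⟪d, q⟫_ℝ →
            ((16 : ℝ) ^ 2 ≤ (y 0 - p0) ^ 2 + (y 1 - p1) ^ 2 → 1 / 2 ≤ (p0 - y 0) * d 0 + (p1 - y 1) * d 1) := by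
        by_cases hs : (16 : ℝ) ^ 2 ≤ (y 0 - p0) ^ 2 + (y 1 - p1) ^ 2
        · set V : EuclideanSpace ℝ (Fin 3) := EuclideanSpace.single (0 : Fin 3) (p0 - y 0) +
            EuclideanSpace.single (1 : Fin 3) (p1 - y 1) with hV
          have hVi : ∀ d : EuclideanSpace ℝ (Fin 3), ⟪d, V⟫_ℝ = (p0 - y 0) * d 0 + (p1 - y 1) * d 1 := by
            intro d; rw [hV, inner_add_right, EuclideanSpace.inner_single_right, EuclideanSpace.inner_single_right]
            simp
          have hV0 : V 0 = p0 - y 0 := by simp [hV]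
          have hV1 : V 1 = p1 - y 1 := by simp [hV]
          have hVn2 : ‖V‖ ^ 2 = (y 0 - p0) ^ 2 + (y 1 - p1) ^ 2 := by
            rw [← real_inner_self_eq_norm_sq, hVi, hV0, hV1]; ring
          have hVn : 16 ≤ ‖V‖ := by nlinarith [norm_nonneg V]
          have hVpos : 0 < ‖V‖ := by linarith
          refine ⟨(1 / ‖V‖) • V, ?_, ?_, ?_⟩
          · rw [norm_smul, norm_div, norm_one, Real.norm_eq_abs, abs_of_pos hVpos]
            exact one_div_mul_cancel hVpos.ne'
          · rw [inner_smul_right, hVi]; simp [he₃]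
          · intro d hdq _
            rw [inner_smul_right, hVi] at hdq
            have : ‖V‖ / 32 ≤ (p0 - y 0) * d 0 + (p1 - y 1) * d 1 := by
              have h' := mul_le_mul_of_nonneg_left hdq hVpos.le
              rw [← mul_assoc, mul_one_div_cancel hVpos.ne', one_mul] at h'
              linarith
            linarith
        · refine ⟨EuclideanSpace.single (0 : Fin 3) (1 : ℝ), by rw [PiLp.norm_single, norm_one], ?_,
            fun d _ hs' => absurd hs' hs⟩
          simp [he₃, EuclideanSpace.inner_single_left]
      obtain ⟨q, hq1, hq0, hqst⟩ := hq
      rcases exists_steering_twinDozen F hn he₃n hq1 hq0 hmenu with ⟨w, hw, hle, hwz, hwq⟩ | ⟨w, hw, hlt, hwz, hwq⟩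
      · obtain ⟨hyw, hst⟩ := hown w hw hle
        have hw1 : ‖F w‖ = 1 := by rw [LinearIsometryEquiv.norm_map, norm_eq_one_of_mem_fccSlots hw]
        exact cont (F w) F hw1 hyw hF hst hwz (hqst _ hwq)
      · obtain ⟨hyw, hst⟩ := hmir w hw hlt
        have hF'𝓕 : F' ∈ 𝓕 := hclosed F hF nn hn hmenu F' hF'
        have hw1 : ‖F' w‖ = 1 := by rw [LinearIsometryEquiv.norm_map, norm_eq_one_of_mem_fccSlots hw]
        have e : F w - (2 * ⟪F w, nn⟫_ℝ) • nn = F' w := (hF' w).symm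
        rw [e] at hwz hwq
        exact cont (F' w) F' hw1 hyw hF'𝓕 hst hwz (hqst _ hwq)

end Summit.Ventures.Crystal3D.Theorems

end
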